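import Summits.KontsevichZagierPeriods.KontsevichZagierPeriods.Theorems.RootDecompWalshStrataHtypeLineSections

/-!
# Root decomposition (Walsh strata), part 52 — H-type fibre discriminants VI: conic edges reparametrised by `x`

The residual family `R-HC` of part 48 consists of the sections of the vertex chart lying over a CONIC edge
`H(x) − m y² = (ℓ(x) + q₂ y)²` (`ℓ = q₀ + q₁ x`) of an H-type cell (`D = H − m y²`, `H = e x² + g`, `e > 0`,
`m ≥ 1`): the locus where the inner root `t = √D` is the affine form `±(ℓ + q₂ y)`.  As a quadratic in `y` the
edge reads `((m + q₂²) y + q₂ ℓ)² = Δ(x)` with the discriminant `Δ = (m + q₂²) H − m ℓ²`, so it has the two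
branches `y = Y_s(x) = (−q₂ ℓ + s √Δ)/(m + q₂²)`, `s = ±1`.  Along a branch the vertex-chart integrand
`γ·Hi(ζ)·g_m(v)` pulls back to the `x`-line (`VertexChart.edge_pullback`, rules (2)–(3)) as

  `ς γ/(m + q₂²)² · Hi(x) · (q₁ g − e q₀ x) · (m ℓ + s q₂ √Δ)² / (H² √Δ) dx`

(`2HY′ − YH′ = −2 (q₁g − e q₀ x) s (mℓ + s q₂√Δ)/((m + q₂²)√Δ)` and `√(H − m Y²) = |mℓ + s q₂ √Δ|/(m + q₂²)`;
`ς = sign (q₁ g − e q₀ ζ)` on the piece).  Here the parameter set is simply the IMAGE `ζ(piece)`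
(Tarski–Seidenberg): the chart ratio `Y/√H` is automatically injective on it, because along the section it
equals `U_m(v)` (52.2, `InBaker.of_Hconic_piece`).  The assembly `R-HC ⟸ R-HLx ∧ R-HCx` (`InBaker.of_Hconics`:
the rest of the section is a rational constant section, a finite set, or — when `Δ ≡ 0` — a line section) is
part 52b (`RootDecompWalshStrataHtypeConicSections`), and the resulting descent
`quadricBakerDescent_of_residuals₅ : R-HLx → R-HCx → R-Eθ → QuadricBakerDescent` is part 52c
(`RootDecompWalshStrataHtypeDescent`).

References: [KontsevichZagier2001 §1.2 rules (1)–(3)], [BCR1998 §2.2].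
-/

noncomputable section

open Set MeasureTheory MvPolynomial Literature.NumberTheory.Transcendental
open Literature.ModelTheory.ExponentialFields (IsSemialgebraic isSemialgebraic_univ isSemialgebraic_empty)
open Summit.KontsevichZagierPeriods.RootDecompWalshStrata.ConicDescent.VertexChart

namespace Summit.KontsevichZagierPeriods.RootDecompWalshStrata.ConicDescent.BallCube

/-! #### 52.1 The discriminant, the branch ordinate, images and finiteness -/

/-- The discriminant `Δ(x) = (m + q₂²)(e x² + g) − m (q₀ + q₁ x)²` of the conic edge as a quadratic in `y`. -/
def cDp (e g m q0 q1 q2 : ℚ) : Polynomial ℚ :=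
  Polynomial.C ((m + q2 ^ 2) * e - m * q1 ^ 2) * Polynomial.X ^ 2 + Polynomial.C (-(2 * m * q0 * q1)) * Polynomial.X +
    Polynomial.C ((m + q2 ^ 2) * g - m * q0 ^ 2)

/-- The branch ordinate `Y_s(x) = (−q₂ ℓ(x) + s √Δ(x))/(m + q₂²)`. -/
def cY (e g m q0 q1 q2 s : ℚ) (x : ℝ) : ℝ :=
  (-(q2 : ℝ) * hLam q0 q1 x + s * √(Polynomial.aeval x (cDp e g m q0 q1 q2))) / ((m : ℝ) + q2 ^ 2)

/-- Its derivative where `Δ > 0`. -/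
def cY' (e g m q0 q1 q2 s : ℚ) (x : ℝ) : ℝ :=
  (-(q2 : ℝ) * q1 + s * (Polynomial.aeval x (Polynomial.derivative (cDp e g m q0 q1 q2)) /
    (2 * √(Polynomial.aeval x (cDp e g m q0 q1 q2))))) / ((m : ℝ) + q2 ^ 2)

variable {e g m q0 q1 q2 s : ℚ}

/-- `Δ(x)` evaluated. [bookkeeping] -/
theorem aeval_cDp (e g m q0 q1 q2 : ℚ) (x : ℝ) :
    Polynomial.aeval x (cDp e g m q0 q1 q2) =
      ((m : ℝ) + q2 ^ 2) * ((e : ℝ) * x ^ 2 + g) - m * ((q0 : ℝ) + q1 * x) ^ 2 := by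
  simp only [cDp, map_add, map_mul, map_pow, Polynomial.aeval_C, Polynomial.aeval_X, eq_ratCast]
  push_cast
  ring

/-- `Δ′(x)` evaluated. [bookkeeping] -/
theorem aeval_derivative_cDp (e g m q0 q1 q2 : ℚ) (x : ℝ) :
    Polynomial.aeval x (Polynomial.derivative (cDp e g m q0 q1 q2)) =
      2 * ((m : ℝ) + q2 ^ 2) * e * x - 2 * m * q1 * ((q0 : ℝ) + q1 * x) := by
  simp only [cDp, Polynomial.derivative_C_mul_X_pow, Polynomial.derivative_C_mul_X,
    Polynomial.derivative_C, add_zero, map_add, map_mul, Polynomial.aeval_C, map_pow, Polynomial.aeval_X,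
    eq_ratCast]
  push_cast
  ring

/-- `Y_s′` where `Δ > 0`. [calculus] -/
theorem hasDerivAt_cY {x : ℝ} (hx : 0 < Polynomial.aeval x (cDp e g m q0 q1 q2)) :
    HasDerivAt (cY e g m q0 q1 q2 s) (cY' e g m q0 q1 q2 s x) x := by
  unfold cY cY'
  exact ((((hasDerivAt_hLam q0 q1 x).const_mul (-(q2 : ℝ))).add
    (((Polynomial.hasDerivAt_aeval (cDp e g m q0 q1 q2) x).sqrt hx.ne').const_mul (s : ℝ))).div_const _)

/-- The image of a semialgebraic function of one variable is semialgebraic (Tarski–Seidenberg).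
[BCR1998 §2.2] -/
theorem isSemialgebraic_image₁ {T : Set (Fin 1 → ℝ)} {ζ : (Fin 1 → ℝ) → ℝ}
    (hζ : IsSemialgebraicFunOn ℚ T ζ) :
    IsSemialgebraic ℚ {t : Fin 1 → ℝ | ∃ b ∈ T, ζ b = t 0} := by
  rw [isSemialgebraicFunOn_iff] at hζ
  convert hζ.image_tail using 1
  ext t
  simp only [mem_setOf_eq, mem_image]
  constructor
  · rintro ⟨b, hb, hbt⟩
    refine ⟨Fin.snoc b (ζ b), ⟨by simpa using hb, by simp⟩, ?_⟩
    funext i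
    rw [Subsingleton.elim i 0, ← hbt]
    exact Fin.snoc_last (α := fun _ => ℝ) (x := ζ b) (p := b)
  · rintro ⟨z, ⟨hz, hzl⟩, rfl⟩
    exact ⟨Fin.init z, hz, hzl.symm⟩

/-- A set of parameters on which `U_m(v)` takes values in the root set of a non-zero real polynomial is finite
(`U_m` is injective on `m v² < 1`). [bookkeeping] -/
theorem finite_of_gU_root (hm : 0 ≤ m) {S : Set (Fin 1 → ℝ)} (hS : ∀ b ∈ S, (m : ℝ) * b 0 ^ 2 < 1)
    {p : Polynomial ℝ} (hp : p ≠ 0) (h : ∀ b ∈ S, p.IsRoot (gU m (b 0))) : S.Finite := by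
  refine Set.Finite.of_finite_image ((Polynomial.finite_setOf_isRoot hp).subset ?_)
    (f := fun b : Fin 1 → ℝ => gU m (b 0)) fun b hb b' hb' hbb => ?_
  · rintro _ ⟨b, hb, rfl⟩
    exact h b hb
  · exact funext fun i => by rw [Subsingleton.elim i 0]; exact gU_inj hm (hS b hb) (hS b' hb') hbb

/-- A set on which a function takes values in the root set of a non-zero rational polynomial and on which that
function is injective is finite. [bookkeeping] -/
theorem finite_of_aeval_root {S : Set (Fin 1 → ℝ)} {ζ : (Fin 1 → ℝ) → ℝ} (hinj : InjOn ζ S)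
    {p : Polynomial ℚ} (hp : p ≠ 0) (h : ∀ b ∈ S, Polynomial.aeval (ζ b) p = 0) : S.Finite := by
  have hp' : p.map (algebraMap ℚ ℝ) ≠ 0 := by
    rw [Ne, Polynomial.map_eq_zero_iff (algebraMap ℚ ℝ).injective]
    exact hp
  refine Set.Finite.of_finite_image ((Polynomial.finite_setOf_isRoot hp').subset ?_) hinj
  rintro _ ⟨b, hb, rfl⟩
  rw [mem_setOf_eq, Polynomial.IsRoot.def, Polynomial.eval_map, ← Polynomial.aeval_def]
  exact h b hb

/-- A one-variable representation with finite domain is a relation, hence in the Baker sector. -/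
theorem InBaker.of_domain_finite (r : KZ.IntegralRep 1) (h : r.domain.Finite) : InBaker (KZ.of r) :=
  InBaker.of_mem_relations (KZ.of_mem_relations_of_volume_eq_zero r (h.measure_zero volume))

/-! #### 52.2 The pullback of a conic branch -/

/-- **Conic-branch pullback.**  A section of the vertex chart lying over the branch `y = Y_s(ζ)` of a conic
edge of an H-type cell, on which `Δ(ζ) > 0` and `q₁ g − e q₀ ζ` has the fixed sign `ς`, lies in the Baker
sector as soon as the one-variable family `R-HCx` does.  The parameter set of the pullback is the image
`ζ(piece)`; injectivity of the chart ratio there is automatic (`Y_s(ζ_b)/√H(ζ_b) = U_m(v_b)`).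
[KontsevichZagier2001 §1.2 rules (2)–(3); BCR1998 §2.2; this node] -/
theorem InBaker.of_Hconic_piece
    (hC : (∀ (e g m γ q0 q1 q2 s : ℚ), 0 < e → 1 ≤ m → (s = 1 ∨ s = -1) →
      ∀ (S : Set (Fin 1 → ℝ)), IsSemialgebraic ℚ S →
        (∀ t ∈ S, (0 ≤ t 0 ∧ t 0 ≤ 1) ∧ 0 < (e : ℝ) * t 0 ^ 2 + g ∧
          0 < ((m : ℝ) + q2 ^ 2) * ((e : ℝ) * t 0 ^ 2 + g) - m * ((q0 : ℝ) + q1 * t 0) ^ 2) →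
        ∀ r : KZ.IntegralRep 1, r.domain = S →
          EqOn r.integrand (fun t => (γ : ℝ) * ((e : ℝ) / 3 * t 0 ^ 3 + g * t 0) * ((q1 : ℝ) * g - e * q0 * t 0) *
            ((m : ℝ) * ((q0 : ℝ) + q1 * t 0) +
              s * q2 * √(((m : ℝ) + q2 ^ 2) * ((e : ℝ) * t 0 ^ 2 + g) - m * ((q0 : ℝ) + q1 * t 0) ^ 2)) ^ 2 /
            (((e : ℝ) * t 0 ^ 2 + g) ^ 2 *
              √(((m : ℝ) + q2 ^ 2) * ((e : ℝ) * t 0 ^ 2 + g) - m * ((q0 : ℝ) + q1 * t 0) ^ 2))) S →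
          InBaker (KZ.of r)))
    (he : 0 < e) (hm : 1 ≤ m) (γ : ℚ) {s ς : ℚ} (hs : s = 1 ∨ s = -1) (hς : ς = 1 ∨ ς = -1)
    {T : Set (Fin 1 → ℝ)} {ζ : (Fin 1 → ℝ) → ℝ} (hζ : IsSemialgebraicFunOn ℚ T ζ)
    (hF : ∀ b ∈ T, (0 < b 0 ∧ (m : ℝ) * b 0 ^ 2 < 1) ∧ (0 ≤ ζ b ∧ ζ b ≤ 1) ∧
      0 < Polynomial.aeval (ζ b) (hP e g) ∧ 0 < Polynomial.aeval (ζ b) (cDp e g m q0 q1 q2) ∧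
      vS (hP e g) (ζ b) * gU m (b 0) = cY e g m q0 q1 q2 s (ζ b) ∧
      0 < (ς : ℝ) * hNum e g q0 q1 (ζ b))
    (r : KZ.IntegralRep 1) (hrd : r.domain = T)
    (hri : EqOn r.integrand (fun b => (γ : ℝ) * ((e : ℝ) / 3 * ζ b ^ 3 + g * ζ b) * gW m (b 0)) T) :
    InBaker (KZ.of r) := by
  classical
  have hm0 : (0 : ℚ) ≤ m := zero_le_one.trans hm
  have he' : (0 : ℝ) < e := by exact_mod_cast he
  have hM0 : (0 : ℝ) < (m : ℝ) + q2 ^ 2 :=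
    add_pos_of_pos_of_nonneg (by exact_mod_cast zero_lt_one.trans_le hm) (sq_nonneg _)
  -- per-point facts on the section
  have hU : ∀ b ∈ T, gU m (b 0) = cY e g m q0 q1 q2 s (ζ b) / vS (hP e g) (ζ b) := fun b hb => by
    have hS := vS_pos (hF b hb).2.2.1
    rw [eq_div_iff hS.ne', mul_comm]
    exact (hF b hb).2.2.2.2.1
  have hV : ∀ b ∈ T, gV m (cY e g m q0 q1 q2 s (ζ b) / vS (hP e g) (ζ b)) = b 0 := fun b hb => by
    rw [← hU b hb, gV_gU hm0 (hF b hb).1.2]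
  -- the parameter set: the image of the section
  set T₀ : Set (Fin 1 → ℝ) := {t | ∃ b ∈ T, ζ b = t 0} with hT₀def
  have hT₀ : IsSemialgebraic ℚ T₀ := isSemialgebraic_image₁ hζ
  -- semialgebraic ingredients on `T₀`
  have hL1 : IsSemialgebraicFunOn ℚ T₀ fun t => hLam q0 q1 (t 0) :=
    (isSemialgebraicFunOn_aeval hT₀ (C q0 + C q1 * X 0 : MvPolynomial (Fin 1) ℚ)).congr fun t _ => by
      simp only [map_add, map_mul, MvPolynomial.aeval_C, MvPolynomial.aeval_X, eq_ratCast, hLam]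
  have hD1 : IsSemialgebraicFunOn ℚ T₀ fun t => Polynomial.aeval (t 0) (cDp e g m q0 q1 q2) :=
    (isSemialgebraicFunOn_aeval hT₀ (C ((m + q2 ^ 2) * e - m * q1 ^ 2) * X 0 ^ 2 +
      C (-(2 * m * q0 * q1)) * X 0 + C ((m + q2 ^ 2) * g - m * q0 ^ 2) : MvPolynomial (Fin 1) ℚ)).congr
      fun t _ => by
        simp only [map_add, map_mul, map_pow, MvPolynomial.aeval_C, MvPolynomial.aeval_X, eq_ratCast, aeval_cDp]
        push_cast
        ring
  have hW1 : IsSemialgebraicFunOn ℚ T₀ fun t => √(Polynomial.aeval (t 0) (cDp e g m q0 q1 q2)) :=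
    IsSemialgebraicFunOn.sqrt_holds hD1
  -- hypotheses of the edge pullback
  have hybs : IsSemialgebraicFunOn ℚ T₀ fun t => cY e g m q0 q1 q2 s (t 0) :=
    ((((isSemialgebraicFunOn_ratCast hT₀ (-q2)).mul_holds hL1).add_holds
      ((isSemialgebraicFunOn_ratCast hT₀ s).mul_holds hW1)).div (isSemialgebraicFunOn_ratCast hT₀ (m + q2 ^ 2))
      (fun _ _ => by push_cast; exact hM0.ne')).congr fun t _ => by
        simp only [Pi.add_apply, Pi.mul_apply, cY]
        push_cast
        ring
  have hyb : ∀ t ∈ T₀, HasDerivAt (cY e g m q0 q1 q2 s) (cY' e g m q0 q1 q2 s (t 0)) (t 0) := by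
    rintro t ⟨b, hb, hbt⟩
    rw [← hbt]
    exact hasDerivAt_cY (hF b hb).2.2.2.1
  have hH : ∀ t ∈ T₀, 0 < Polynomial.aeval (t 0) (hP e g) := by
    rintro t ⟨b, hb, hbt⟩
    rw [← hbt]
    exact (hF b hb).2.2.1
  have hrx : ∀ t ∈ T₀, (m : ℝ) *
      ((cY e g m q0 q1 q2 s (t 0) - Polynomial.aeval (t 0) (0 : Polynomial ℚ)) / vS (hP e g) (t 0)) ^ 2 < 1 := by
    rintro t ⟨b, hb, hbt⟩
    rw [map_zero, sub_zero, ← hbt, ← hU b hb]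
    exact m_gU_sq_lt hm0 (hF b hb).1.2
  have hinj : ∀ u ∈ T₀, ∀ t ∈ T₀,
      (cY e g m q0 q1 q2 s (u 0) - Polynomial.aeval (u 0) (0 : Polynomial ℚ)) / vS (hP e g) (u 0) =
        (cY e g m q0 q1 q2 s (t 0) - Polynomial.aeval (t 0) (0 : Polynomial ℚ)) / vS (hP e g) (t 0) →
        u 0 = t 0 := by
    rintro u ⟨b, hb, hbu⟩ t ⟨b', hb', hbt⟩ hut
    rw [map_zero, sub_zero, map_zero, sub_zero, ← hbu, ← hbt, ← hU b hb, ← hU b' hb'] at hut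
    have hbb : b = b' :=
      funext fun i => by rw [Subsingleton.elim i 0]; exact gU_inj hm0 (hF b hb).1.2 (hF b' hb').1.2 hut
    rw [← hbu, ← hbt, hbb]
  have hsurj : ∀ w ∈ r.domain, ∃ t ∈ T₀,
      gV m ((cY e g m q0 q1 q2 s (t 0) - Polynomial.aeval (t 0) (0 : Polynomial ℚ)) / vS (hP e g) (t 0)) = w 0 :=
    fun w hw => by
      have hwT : w ∈ T := hrd ▸ hw
      refine ⟨fun _ => ζ w, ⟨w, hwT, rfl⟩, ?_⟩
      rw [map_zero, sub_zero]
      exact hV w hwT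
  have hRe : ∀ t ∈ T₀,
      lift₁ (fun x => gV m ((cY e g m q0 q1 q2 s x - Polynomial.aeval x (0 : Polynomial ℚ)) / vS (hP e g) x)) t ∈
          r.domain →
        r.integrand (lift₁ (fun x => gV m ((cY e g m q0 q1 q2 s x - Polynomial.aeval x (0 : Polynomial ℚ)) /
            vS (hP e g) x)) t) =
          vF m (hPi e g) γ (t 0)
            (gV m ((cY e g m q0 q1 q2 s (t 0) - Polynomial.aeval (t 0) (0 : Polynomial ℚ)) / vS (hP e g) (t 0))) := by
    rintro t ⟨b, hb, hbt⟩ -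
    have hlift : lift₁ (fun x => gV m ((cY e g m q0 q1 q2 s x - Polynomial.aeval x (0 : Polynomial ℚ)) /
        vS (hP e g) x)) t = b := by
      funext i
      simp only [lift₁, map_zero, sub_zero]
      rw [← hbt, hV b hb, Subsingleton.elim i 0]
    rw [hlift, hri hb, map_zero, sub_zero]
    dsimp only
    rw [← hbt, hV b hb, vF, aeval_hPi]
  -- the pulled-back integrand
  set R : (Fin 1 → ℝ) → ℝ := fun t => ((ς * γ / (m + q2 ^ 2) ^ 2 : ℚ) : ℝ) *
      ((e : ℝ) / 3 * t 0 ^ 3 + g * t 0) * ((q1 : ℝ) * g - e * q0 * t 0) *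
      ((m : ℝ) * ((q0 : ℝ) + q1 * t 0) +
        s * q2 * √(((m : ℝ) + q2 ^ 2) * ((e : ℝ) * t 0 ^ 2 + g) - m * ((q0 : ℝ) + q1 * t 0) ^ 2)) ^ 2 /
      (((e : ℝ) * t 0 ^ 2 + g) ^ 2 *
        √(((m : ℝ) + q2 ^ 2) * ((e : ℝ) * t 0 ^ 2 + g) - m * ((q0 : ℝ) + q1 * t 0) ^ 2)) with hRdef
  have hWE : IsSemialgebraicFunOn ℚ T₀
      fun t => √(((m : ℝ) + q2 ^ 2) * ((e : ℝ) * t 0 ^ 2 + g) - m * ((q0 : ℝ) + q1 * t 0) ^ 2) :=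
    hW1.congr fun t _ => by simp only [aeval_cDp]
  have hPol : IsSemialgebraicFunOn ℚ T₀ fun t => ((ς * γ / (m + q2 ^ 2) ^ 2 : ℚ) : ℝ) *
      ((e : ℝ) / 3 * t 0 ^ 3 + g * t 0) * ((q1 : ℝ) * g - e * q0 * t 0) :=
    (isSemialgebraicFunOn_aeval hT₀ (C (ς * γ / (m + q2 ^ 2) ^ 2) * (C (e / 3) * X 0 ^ 3 + C g * X 0) *
      (C q1 * C g - C e * C q0 * X 0) : MvPolynomial (Fin 1) ℚ)).congr fun t _ => by
        simp only [map_add, map_sub, map_mul, map_pow, MvPolynomial.aeval_C, MvPolynomial.aeval_X, eq_ratCast]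
        push_cast
        ring
  have hQ1 : IsSemialgebraicFunOn ℚ T₀ fun t => (m : ℝ) * ((q0 : ℝ) + q1 * t 0) +
      s * q2 * √(((m : ℝ) + q2 ^ 2) * ((e : ℝ) * t 0 ^ 2 + g) - m * ((q0 : ℝ) + q1 * t 0) ^ 2) :=
    ((isSemialgebraicFunOn_aeval hT₀ (C m * (C q0 + C q1 * X 0) : MvPolynomial (Fin 1) ℚ)).add_holds
      ((isSemialgebraicFunOn_ratCast hT₀ (s * q2)).mul_holds hWE)).congr fun t _ => by
        simp only [Pi.add_apply, Pi.mul_apply, map_add, map_mul, MvPolynomial.aeval_C, MvPolynomial.aeval_X,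
          eq_ratCast]
        push_cast
        ring
  have hNumR : IsSemialgebraicFunOn ℚ T₀ fun t => ((ς * γ / (m + q2 ^ 2) ^ 2 : ℚ) : ℝ) *
      ((e : ℝ) / 3 * t 0 ^ 3 + g * t 0) * ((q1 : ℝ) * g - e * q0 * t 0) *
      ((m : ℝ) * ((q0 : ℝ) + q1 * t 0) +
        s * q2 * √(((m : ℝ) + q2 ^ 2) * ((e : ℝ) * t 0 ^ 2 + g) - m * ((q0 : ℝ) + q1 * t 0) ^ 2)) ^ 2 :=
    (hPol.mul_holds (hQ1.mul_holds hQ1)).congr fun t _ => by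
      simp only [Pi.mul_apply]
      ring
  have hDen : IsSemialgebraicFunOn ℚ T₀ fun t => ((e : ℝ) * t 0 ^ 2 + g) ^ 2 *
      √(((m : ℝ) + q2 ^ 2) * ((e : ℝ) * t 0 ^ 2 + g) - m * ((q0 : ℝ) + q1 * t 0) ^ 2) :=
    ((isSemialgebraicFunOn_aeval hT₀ ((C e * X 0 ^ 2 + C g) ^ 2 : MvPolynomial (Fin 1) ℚ)).mul_holds hWE).congr
      fun t _ => by
        simp only [Pi.mul_apply, map_add, map_mul, map_pow, MvPolynomial.aeval_C, MvPolynomial.aeval_X, eq_ratCast]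
  have hDen0 : ∀ t ∈ T₀, ((e : ℝ) * t 0 ^ 2 + g) ^ 2 *
      √(((m : ℝ) + q2 ^ 2) * ((e : ℝ) * t 0 ^ 2 + g) - m * ((q0 : ℝ) + q1 * t 0) ^ 2) ≠ 0 := by
    rintro t ⟨b, hb, hbt⟩
    have hA := (hF b hb).2.2.1
    have hD := (hF b hb).2.2.2.1
    rw [aeval_hP, hbt] at hA
    rw [aeval_cDp, hbt] at hD
    exact mul_ne_zero (pow_ne_zero 2 hA.ne') (Real.sqrt_pos.2 hD).ne'
  have hR : IsSemialgebraicFunOn ℚ T₀ R := (hNumR.div hDen hDen0).congr fun t _ => rfl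
  have hRE : ∀ t ∈ T₀, R t =
      (γ : ℝ) * Polynomial.aeval (t 0) (hPi e g) *
        (vS (hP e g) (t 0) *
          gT m (gV m ((cY e g m q0 q1 q2 s (t 0) - Polynomial.aeval (t 0) (0 : Polynomial ℚ)) / vS (hP e g) (t 0)))) *
        (|2 * Polynomial.aeval (t 0) (hP e g) *
              (cY' e g m q0 q1 q2 s (t 0) - Polynomial.aeval (t 0) (Polynomial.derivative (0 : Polynomial ℚ))) -
            (cY e g m q0 q1 q2 s (t 0) - Polynomial.aeval (t 0) (0 : Polynomial ℚ)) *
              Polynomial.aeval (t 0) (Polynomial.derivative (hP e g))| /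
          (2 * Polynomial.aeval (t 0) (hP e g) ^ 2)) := by
    rintro t ⟨b, hb, hbt⟩
    obtain ⟨⟨hb0, hmb⟩, -, hA, hD, hbr, hNς⟩ := hF b hb
    rw [hbt] at hA hD hbr hNς
    simp only [map_zero, sub_zero]
    have hS := vS_pos hA
    have hAe : Polynomial.aeval (t 0) (hP e g) = (e : ℝ) * t 0 ^ 2 + g := aeval_hP e g (t 0)
    have hA' : (e : ℝ) * t 0 ^ 2 + g ≠ 0 := by rw [hAe] at hA; exact hA.ne'
    have hM0' : (m : ℝ) + q2 ^ 2 ≠ 0 := hM0.ne'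
    have hw0 : 0 < √(Polynomial.aeval (t 0) (cDp e g m q0 q1 q2)) := Real.sqrt_pos.2 hD
    have hw0' : √(Polynomial.aeval (t 0) (cDp e g m q0 q1 q2)) ≠ 0 := hw0.ne'
    have hw2 : √(Polynomial.aeval (t 0) (cDp e g m q0 q1 q2)) ^ 2 =
        ((m : ℝ) + q2 ^ 2) * ((e : ℝ) * t 0 ^ 2 + g) - m * ((q0 : ℝ) + q1 * t 0) ^ 2 := by
      rw [Real.sq_sqrt hD.le, aeval_cDp]
    have hs2 : (s : ℝ) ^ 2 = 1 := by rcases hs with rfl | rfl <;> norm_num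
    -- `(m + q₂²)·Y = −q₂ ℓ + s √Δ`, `(m + q₂²)·Y′ = −q₂ q₁ + s Δ′/(2√Δ)`
    have hMY : ((m : ℝ) + q2 ^ 2) * cY e g m q0 q1 q2 s (t 0) =
        -(q2 : ℝ) * ((q0 : ℝ) + q1 * t 0) + s * √(Polynomial.aeval (t 0) (cDp e g m q0 q1 q2)) := by
      rw [cY, hLam, mul_div_assoc', mul_div_cancel_left₀ _ hM0.ne']
    have hMY' : ((m : ℝ) + q2 ^ 2) * cY' e g m q0 q1 q2 s (t 0) =
        -(q2 : ℝ) * q1 + s * (Polynomial.aeval (t 0) (Polynomial.derivative (cDp e g m q0 q1 q2)) /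
          (2 * √(Polynomial.aeval (t 0) (cDp e g m q0 q1 q2)))) := by
      rw [cY', mul_div_assoc', mul_div_cancel_left₀ _ hM0.ne']
    have hu : 2 * √(Polynomial.aeval (t 0) (cDp e g m q0 q1 q2)) *
        (Polynomial.aeval (t 0) (Polynomial.derivative (cDp e g m q0 q1 q2)) /
          (2 * √(Polynomial.aeval (t 0) (cDp e g m q0 q1 q2)))) =
        2 * ((m : ℝ) + q2 ^ 2) * e * t 0 - 2 * m * q1 * ((q0 : ℝ) + q1 * t 0) := by
      rw [← aeval_derivative_cDp, mul_div_cancel₀ _ (mul_ne_zero two_ne_zero hw0')]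
    -- the chart point and `√H · T_m = |m ℓ + s q₂ √Δ|/(m + q₂²)`
    have hgV : gV m (cY e g m q0 q1 q2 s (t 0) / vS (hP e g) (t 0)) = b 0 := by
      rw [← hbt]; exact hV b hb
    have hQ : Polynomial.aeval (t 0) (hP e g) - m * (vS (hP e g) (t 0) * gU m (b 0)) ^ 2 =
        (((m : ℝ) * ((q0 : ℝ) + q1 * t 0) + s * q2 * √(Polynomial.aeval (t 0) (cDp e g m q0 q1 q2))) /
          ((m : ℝ) + q2 ^ 2)) ^ 2 := by
      rw [hbr, div_pow, eq_div_iff (pow_ne_zero 2 hM0.ne'), hAe]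
      linear_combination (-(m : ℝ) * (((m : ℝ) + q2 ^ 2) * cY e g m q0 q1 q2 s (t 0) +
          (-(q2 : ℝ) * ((q0 : ℝ) + q1 * t 0) + s * √(Polynomial.aeval (t 0) (cDp e g m q0 q1 q2))))) * hMY +
        (-((m : ℝ) + q2 ^ 2) * √(Polynomial.aeval (t 0) (cDp e g m q0 q1 q2)) ^ 2) * hs2 +
        (-((m : ℝ) + q2 ^ 2)) * hw2
    have hgT : vS (hP e g) (t 0) * gT m (b 0) =
        |(m : ℝ) * ((q0 : ℝ) + q1 * t 0) + s * q2 * √(Polynomial.aeval (t 0) (cDp e g m q0 q1 q2))| /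
          ((m : ℝ) + q2 ^ 2) := by
      rw [vS_mul_gT hm0 hA.le hmb.le, hQ, Real.sqrt_sq_eq_abs, abs_div, abs_of_pos hM0]
    -- the edge numerator `2HY′ − YH′ = −2 n s (mℓ + s q₂√Δ)/((m + q₂²)√Δ)`
    have hN : 2 * Polynomial.aeval (t 0) (hP e g) * cY' e g m q0 q1 q2 s (t 0) -
        cY e g m q0 q1 q2 s (t 0) * Polynomial.aeval (t 0) (Polynomial.derivative (hP e g)) =
        -(2 * s * hNum e g q0 q1 (t 0) *
          ((m : ℝ) * ((q0 : ℝ) + q1 * t 0) + s * q2 * √(Polynomial.aeval (t 0) (cDp e g m q0 q1 q2)))) /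
          (((m : ℝ) + q2 ^ 2) * √(Polynomial.aeval (t 0) (cDp e g m q0 q1 q2))) := by
      rw [eq_div_iff (mul_ne_zero hM0.ne' hw0'), aeval_derivative_hP, hAe]
      unfold hNum
      linear_combination (2 * ((e : ℝ) * t 0 ^ 2 + g) * √(Polynomial.aeval (t 0) (cDp e g m q0 q1 q2))) * hMY' +
        (-(2 * (e : ℝ) * t 0 * √(Polynomial.aeval (t 0) (cDp e g m q0 q1 q2)))) * hMY +
        (((e : ℝ) * t 0 ^ 2 + g) * s) * hu +
        (-(2 * (e : ℝ) * t 0 * s)) * hw2 +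
        (2 * ((q1 : ℝ) * g - e * q0 * t 0) * q2 * √(Polynomial.aeval (t 0) (cDp e g m q0 q1 q2))) * hs2
    have hsabs : |(s : ℝ)| = 1 := by rcases hs with rfl | rfl <;> simp
    have hnabs : |hNum e g q0 q1 (t 0)| = (ς : ℝ) * hNum e g q0 q1 (t 0) := by
      rcases hς with rfl | rfl
      · rw [Rat.cast_one, one_mul] at hNς ⊢
        exact abs_of_pos hNς
      · rw [Rat.cast_neg, Rat.cast_one] at hNς ⊢
        rw [abs_of_neg (by linarith)]
        ring
    have habs : |-(2 * s * hNum e g q0 q1 (t 0) *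
          ((m : ℝ) * ((q0 : ℝ) + q1 * t 0) + s * q2 * √(Polynomial.aeval (t 0) (cDp e g m q0 q1 q2)))) /
          (((m : ℝ) + q2 ^ 2) * √(Polynomial.aeval (t 0) (cDp e g m q0 q1 q2)))| =
        2 * ((ς : ℝ) * hNum e g q0 q1 (t 0)) *
          |(m : ℝ) * ((q0 : ℝ) + q1 * t 0) + s * q2 * √(Polynomial.aeval (t 0) (cDp e g m q0 q1 q2))| /
          (((m : ℝ) + q2 ^ 2) * √(Polynomial.aeval (t 0) (cDp e g m q0 q1 q2))) := by
      rw [abs_div, abs_neg, abs_mul, abs_mul, abs_mul, abs_two, hsabs, hnabs, abs_of_pos (mul_pos hM0 hw0)]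
      ring
    rw [hgV, hgT, hN, habs, aeval_hPi, hAe, hRdef]
    dsimp only
    rw [← aeval_cDp, ← sq_abs ((m : ℝ) * ((q0 : ℝ) + q1 * t 0) +
      s * q2 * √(Polynomial.aeval (t 0) (cDp e g m q0 q1 q2)))]
    unfold hNum
    push_cast
    field_simp
  -- pull back
  obtain ⟨r₀, hd₀, hi₀, hrel⟩ := edge_pullback (Y₀ := 0) (yb := cY e g m q0 q1 q2 s)
    (yb' := cY' e g m q0 q1 q2 s) hm0 (hPi e g) γ r hT₀ hybs hyb hH hrx hinj hsurj hRe R hR hRE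
  have h₀ : InBaker (KZ.of r₀) := by
    refine hC e g m (ς * γ / (m + q2 ^ 2) ^ 2) q0 q1 q2 s he hm hs r₀.domain r₀.isSemialgebraic_domain
      (fun t ht => ?_) r₀ rfl (fun t _ => by rw [hi₀])
    rw [hd₀] at ht
    obtain ⟨⟨b, hb, hbt⟩, -⟩ := ht
    obtain ⟨-, h01, hA, hD, -⟩ := hF b hb
    rw [hbt] at h01 hA hD
    rw [aeval_hP] at hA
    rw [aeval_cDp] at hD
    exact ⟨h01, hA, hD⟩
  have hrel' := KZ.relations.neg_mem hrel
  rw [neg_sub] at hrel'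
  exact InBaker.congr h₀ hrel'

end Summit.KontsevichZagierPeriods.RootDecompWalshStrata.ConicDescent.BallCube
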